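import Mathlib
import HarnessLib
import Summits.Ventures.LatticeQCDFlow.Scaling.AutoregressiveGaugeHeatBathAnyDim
import Summits.Ventures.LatticeQCDFlow.Scaling.AutoregressiveGaugeHeatBathComb
import Summits.Ventures.LatticeQCDFlow.Scaling.AutoregressiveGaugeHeatBathDimensionGap
import Summits.Ventures.LatticeQCDFlow.Scaling.TorusRankedLayers
import Summits.Ventures.LatticeQCDFlow.Scaling.TorusRankedParityBound

/-!
# LatticeQCDFlow / Scaling — the scorecard of one-plaquette heat-bath autoregression as an exact-sampler
# proposal: `m/M ≤ acceptance`, `τ_int ≤ M/m − 1/2` at EVERY volume in `d = 2` (the comb); a Doeblin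
# exponent of `(d−1)(d−2)L^d/2 + (d−1)L^{d−1}` plaquettes for the layers and of at least `#plaquettes/6`
# for ANY ranked structure in `d ≥ 3`

HONEST FRAMING: exact (Metropolis-corrected) sampling algorithms for lattice gauge theory;
figures of merit are autocorrelation/cost numbers at stated couplings and volumes; no
continuum-physics claim.

Venture `LatticeQCDFlow` (cell pub-lqcd), topic `Scaling`, FANOUT row 30 (lean-1, GEN-24) — OUR WORK on
THEORY-2.md §4 row C5, assembling the generation's files: `…HeatBathRanked` (RX: heat-bath exactness on
ranked collections), `…HeatBathComb` (CS: the comb of `(ℤ/L)²`), `…HeatBathAnyDim` (AD: Doeblin law and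
pointwise acceptance for plaquette-block proposals in every dimension), `…HeatBathDimensionGap` (DG) and
`TorusRankedLayers` (LY).  `w` continuous with `0 < m ≤ w ≤ M`, `L ≥ 2`.

* §1 `d = 2`, THE COMB (all plaquettes but `q₀ = ((−1,−1); 0, 1)`, `k = 1`): **`comb_imhAcceptQ_ge`** —
  the exact heat-bath autoregressive sampler along the comb, proposed to the Metropolis step for the full
  periodic weight `∏_{all p} w(U_p)`, is accepted with probability `≥ m/M` from EVERY state for EVERY
  proposal; **`comb_autocorrelation`** — the resulting exact chain has `|C_f(t)| ≤ (1 − m/M)^t ∫f² dπ` and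
  `τ_int(f) ≤ M/m − 1/2` for every bounded measurable centred `f`, AT EVERY VOLUME (for the Wilson weight
  `M/m = e^{2β}`): the first volume-independent certified `τ_int` of the lineage for an exact sampler of
  the periodic two-dimensional target.
* §2 every `d = n + 2`, THE LAYERS: **`layers_imhAcceptQ_ge`** — acceptance `≥ (m/M)^k`, `k` = the
  plaquettes off the layers; **`layers_imhAcceptQ_ge_three`** — `d = 3`: `≥ (m/M)^{L³ + 2L²}`.
* §3 `d ≥ 3`, THE GAP: **`ranked_doeblin_floor_le_pow_card_div_six`** — for EVERY ranked structure the
  certified floor `(m/M)^k` is `≤ (m/M)^{#plaquettes/6}` (cube counting), and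
  **`ranked_doeblin_floor_le_pow_parity`** — `≤ (m/M)^{#plaquettes + #sites − #links − 1}`
  (`TorusRankedParityBound`: `k ≥ (d−1)(d−2)/2·L^d − 1`, e.g. `(m/M)^{L³−1}` in `d = 3` against the layers'
  `(m/M)^{L³+2L²}`): the guarantee this route can give decays with the volume in three and more
  dimensions.  NOT CLAIMED: that the samplers themselves slow down with the volume in `d ≥ 3` (a lower
  bound on `τ_int` would need the law of the uncovered plaquettes under the proposal); anything about
  non-heat-bath conditioners.

No `def`, no `sorry`, nothing cited as a fact beyond the tree.
-/

noncomputable section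

namespace Summit.Ventures.LatticeQCDFlow.Theory2.Autoregressive

open MeasureTheory ProbabilityTheory Function Finset
open Literature.MathematicalPhysics.QuantumFieldTheory Literature.MathematicalPhysics.QuantumLattice
open Summit.Ventures.LatticeQCDFlow.Exactness Summit.Ventures.LatticeQCDFlow.Scoring

variable {n L : ℕ} [NeZero L] {G : Type*} [Group G] [TopologicalSpace G] [IsTopologicalGroup G]
  [CompactSpace G] [SecondCountableTopology G] [MeasurableSpace G] [BorelSpace G]

/-! ## §1 Two dimensions: the comb -/

/-- **THE COMB: acceptance `≥ m/M` pointwise.**  `L ≥ 2`; for every duplicate-free list `l` of all links,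
every state `U` and proposal `V`, the Metropolis–Hastings acceptance of the comb heat-bath hybrid `H_l`
against the full periodic weight is at least `m/M`. [ours] -/
theorem comb_imhAcceptQ_ge (hL : 2 ≤ L) {w : G → ℝ} (hw : Continuous w) {m M : ℝ} (hm0 : 0 < m)
    (hm : ∀ g, m ≤ w g) (hM : ∀ g, w g ≤ M)
    (l : List (Edge 2 L)) (hl : l.Nodup) (hall : ∀ e : Edge 2 L, e ∈ l) (U V : GaugeConfig 2 L G) :
    m / M ≤
      imhAcceptQ (fun U : GaugeConfig 2 L G => ∏ p : Plaquette 2 L, w (plaquetteHolonomy U p.1 p.2.1.1 p.2.1.2))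
        (fun U : GaugeConfig 2 L G => (l.map fun b => ∏ p ∈ (Finset.univ.erase (((![-1, -1] : Site 2 L),
            ⟨((0 : Fin 2), (1 : Fin 2)), by decide⟩) : Plaquette 2 L)).filter
              (fun p' => (if p'.1 1 = -1 then (p'.1.shift 0, (1 : Fin 2)) else (p'.1.shift 1, (0 : Fin 2))) = b),
            w (plaquetteHolonomy U p.1 p.2.1.1 p.2.1.2) / (∫ g, w g ∂(haarProbability G))).prod *
          coordAvg (haarProbability G) l.toFinset
            (fun V : GaugeConfig 2 L G => ∏ p ∈ (Finset.univ.erase (((![-1, -1] : Site 2 L),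
              ⟨((0 : Fin 2), (1 : Fin 2)), by decide⟩) : Plaquette 2 L)),
                w (plaquetteHolonomy V p.1 p.2.1.1 p.2.1.2)) U /
          (∫ V, ∏ p ∈ (Finset.univ.erase (((![-1, -1] : Site 2 L),
              ⟨((0 : Fin 2), (1 : Fin 2)), by decide⟩) : Plaquette 2 L)),
                w (plaquetteHolonomy V p.1 p.2.1.1 p.2.1.2)
            ∂(Measure.pi fun _ : Edge 2 L => haarProbability G))) U V := by
  have h := ranked_imhAcceptQ_ge (G := G) hL hw hm0 hm hM _ _ (fun p _ => comb_mem_links p) _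
    (comb_rank_lt hL) l hl hall U V
  rwa [card_univ_sdiff_erase, pow_one] at h

/-- **THE COMB: `τ_int ≤ M/m − 1/2` at every volume.**  With `π = (F/Z)·Haar^{⊗E}` the periodic target
(`F = ∏_{all p} w(U_p)`) and `q = (F_B/Z_B)·Haar^{⊗E}` the law of the exact comb sampler (`B` = all
plaquettes but `q₀`; `comb_arHybrid_eq_target`), the exact independence Metropolis kernel has
`|C_f(t)| ≤ (1 − m/M)^t ∫f² dπ` for all `t` and `τ_int(f) ≤ M/m − 1/2`, for every bounded measurable
`π`-centred `f` and EVERY `L`. [ours] -/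
theorem comb_autocorrelation {w : G → ℝ} (hw : Continuous w) {m M : ℝ} (hm0 : 0 < m)
    (hm : ∀ g, m ≤ w g) (hM : ∀ g, w g ≤ M)
    (π q : Measure (GaugeConfig 2 L G)) [IsProbabilityMeasure π] [IsProbabilityMeasure q]
    (hπ : π = (Measure.pi fun _ : Edge 2 L => haarProbability G).withDensity fun U =>
      ENNReal.ofReal ((∏ p : Plaquette 2 L, w (plaquetteHolonomy U p.1 p.2.1.1 p.2.1.2)) /
        ∫ V, ∏ p : Plaquette 2 L, w (plaquetteHolonomy V p.1 p.2.1.1 p.2.1.2)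
          ∂(Measure.pi fun _ : Edge 2 L => haarProbability G)))
    (hq : q = (Measure.pi fun _ : Edge 2 L => haarProbability G).withDensity fun U =>
      ENNReal.ofReal ((∏ p ∈ (Finset.univ.erase (((![-1, -1] : Site 2 L),
          ⟨((0 : Fin 2), (1 : Fin 2)), by decide⟩) : Plaquette 2 L)),
            w (plaquetteHolonomy U p.1 p.2.1.1 p.2.1.2)) /
        ∫ V, ∏ p ∈ (Finset.univ.erase (((![-1, -1] : Site 2 L),
          ⟨((0 : Fin 2), (1 : Fin 2)), by decide⟩) : Plaquette 2 L)),
            w (plaquetteHolonomy V p.1 p.2.1.1 p.2.1.2)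
          ∂(Measure.pi fun _ : Edge 2 L => haarProbability G)))
    {f : GaugeConfig 2 L G → ℝ} (hf : Measurable f) {C : ℝ} (hC : ∀ x, |f x| ≤ C)
    (hf0 : ∫ U, f U ∂π = 0) :
    (∀ t : ℕ, |autocov (indepMH q fun U =>
        ((∫ V, ∏ p : Plaquette 2 L, w (plaquetteHolonomy V p.1 p.2.1.1 p.2.1.2)
            ∂(Measure.pi fun _ : Edge 2 L => haarProbability G)) /
          ((∫ V, ∏ p ∈ (Finset.univ.erase (((![-1, -1] : Site 2 L),
              ⟨((0 : Fin 2), (1 : Fin 2)), by decide⟩) : Plaquette 2 L)),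
                w (plaquetteHolonomy V p.1 p.2.1.1 p.2.1.2)
            ∂(Measure.pi fun _ : Edge 2 L => haarProbability G)) *
            ∏ p ∈ Finset.univ \ (Finset.univ.erase (((![-1, -1] : Site 2 L),
              ⟨((0 : Fin 2), (1 : Fin 2)), by decide⟩) : Plaquette 2 L)),
                w (plaquetteHolonomy U p.1 p.2.1.1 p.2.1.2)))⁻¹) π f t|
        ≤ (1 - m / M) ^ t * ∫ x, f x ^ 2 ∂π) ∧
      tauInt (fun t => autocov (indepMH q fun U =>
        ((∫ V, ∏ p : Plaquette 2 L, w (plaquetteHolonomy V p.1 p.2.1.1 p.2.1.2)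
            ∂(Measure.pi fun _ : Edge 2 L => haarProbability G)) /
          ((∫ V, ∏ p ∈ (Finset.univ.erase (((![-1, -1] : Site 2 L),
              ⟨((0 : Fin 2), (1 : Fin 2)), by decide⟩) : Plaquette 2 L)),
                w (plaquetteHolonomy V p.1 p.2.1.1 p.2.1.2)
            ∂(Measure.pi fun _ : Edge 2 L => haarProbability G)) *
            ∏ p ∈ Finset.univ \ (Finset.univ.erase (((![-1, -1] : Site 2 L),
              ⟨((0 : Fin 2), (1 : Fin 2)), by decide⟩) : Plaquette 2 L)),
                w (plaquetteHolonomy U p.1 p.2.1.1 p.2.1.2)))⁻¹) π f t /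
          autocov (indepMH q fun U =>
        ((∫ V, ∏ p : Plaquette 2 L, w (plaquetteHolonomy V p.1 p.2.1.1 p.2.1.2)
            ∂(Measure.pi fun _ : Edge 2 L => haarProbability G)) /
          ((∫ V, ∏ p ∈ (Finset.univ.erase (((![-1, -1] : Site 2 L),
              ⟨((0 : Fin 2), (1 : Fin 2)), by decide⟩) : Plaquette 2 L)),
                w (plaquetteHolonomy V p.1 p.2.1.1 p.2.1.2)
            ∂(Measure.pi fun _ : Edge 2 L => haarProbability G)) *
            ∏ p ∈ Finset.univ \ (Finset.univ.erase (((![-1, -1] : Site 2 L),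
              ⟨((0 : Fin 2), (1 : Fin 2)), by decide⟩) : Plaquette 2 L)),
                w (plaquetteHolonomy U p.1 p.2.1.1 p.2.1.2)))⁻¹) π f 0) ≤
        M / m - 1 / 2 := by
  have h := plaquetteBlockProposal_autocorrelation (G := G) hw hm0 hm hM
    (Finset.univ.erase (((![-1, -1] : Site 2 L), ⟨((0 : Fin 2), (1 : Fin 2)), by decide⟩) :
      Plaquette 2 L)) π q hπ hq hf hC hf0
  rwa [card_univ_sdiff_erase, pow_one, pow_one] at h

/-! ## §2 Every dimension: the layers -/

/-- **THE LAYERS: acceptance `≥ (m/M)^k`** (`d = n + 2`, `L ≥ 2`), `k` = the number of plaquettes off the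
layered collection, for every duplicate-free list of all links, every state and every proposal of the
exact layered heat-bath sampler. [ours] -/
theorem layers_imhAcceptQ_ge (hL : 2 ≤ L) {w : G → ℝ} (hw : Continuous w) {m M : ℝ} (hm0 : 0 < m)
    (hm : ∀ g, m ≤ w g) (hM : ∀ g, w g ≤ M)
    (l : List (Edge (n + 2) L)) (hl : l.Nodup) (hall : ∀ e : Edge (n + 2) L, e ∈ l)
    (U V : GaugeConfig (n + 2) L G) :
    (m / M) ^ (Finset.univ \ (Finset.univ : Finset (Plaquette (n + 2) L)).filter
        (fun p => p.1 (Fin.last (n + 1)) ≠ -1 ∧ p.2.1.2 = Fin.last (n + 1))).card ≤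
      imhAcceptQ
        (fun U : GaugeConfig (n + 2) L G => ∏ p : Plaquette (n + 2) L, w (plaquetteHolonomy U p.1 p.2.1.1 p.2.1.2))
        (fun U : GaugeConfig (n + 2) L G => (l.map fun b => ∏ p ∈ ((Finset.univ : Finset (Plaquette (n + 2) L)).filter
            (fun p => p.1 (Fin.last (n + 1)) ≠ -1 ∧ p.2.1.2 = Fin.last (n + 1))).filter
              (fun p' => ((p'.1.shift p'.2.1.2, p'.2.1.1) : Edge (n + 2) L) = b),
            w (plaquetteHolonomy U p.1 p.2.1.1 p.2.1.2) / (∫ g, w g ∂(haarProbability G))).prod *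
          coordAvg (haarProbability G) l.toFinset
            (fun V : GaugeConfig (n + 2) L G => ∏ p ∈ (Finset.univ : Finset (Plaquette (n + 2) L)).filter
              (fun p => p.1 (Fin.last (n + 1)) ≠ -1 ∧ p.2.1.2 = Fin.last (n + 1)),
                w (plaquetteHolonomy V p.1 p.2.1.1 p.2.1.2)) U /
          (∫ V, ∏ p ∈ (Finset.univ : Finset (Plaquette (n + 2) L)).filter
              (fun p => p.1 (Fin.last (n + 1)) ≠ -1 ∧ p.2.1.2 = Fin.last (n + 1)),
                w (plaquetteHolonomy V p.1 p.2.1.1 p.2.1.2)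
            ∂(Measure.pi fun _ : Edge (n + 2) L => haarProbability G))) U V :=
  ranked_imhAcceptQ_ge hL hw hm0 hm hM _ _ (fun p _ => layers_mem_links p) _ (layers_rank_lt hL)
    l hl hall U V

/-- **THE LAYERS IN `d = 3`: acceptance `≥ (m/M)^{L³ + 2L²}`** from every state. [ours] -/
theorem layers_imhAcceptQ_ge_three (hL : 2 ≤ L) {w : G → ℝ} (hw : Continuous w) {m M : ℝ}
    (hm0 : 0 < m) (hm : ∀ g, m ≤ w g) (hM : ∀ g, w g ≤ M)
    (l : List (Edge 3 L)) (hl : l.Nodup) (hall : ∀ e : Edge 3 L, e ∈ l) (U V : GaugeConfig 3 L G) :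
    (m / M) ^ (L ^ 3 + 2 * L ^ 2) ≤
      imhAcceptQ
        (fun U : GaugeConfig 3 L G => ∏ p : Plaquette 3 L, w (plaquetteHolonomy U p.1 p.2.1.1 p.2.1.2))
        (fun U : GaugeConfig 3 L G => (l.map fun b => ∏ p ∈ ((Finset.univ : Finset (Plaquette 3 L)).filter
            (fun p => p.1 (Fin.last 2) ≠ -1 ∧ p.2.1.2 = Fin.last 2)).filter
              (fun p' => ((p'.1.shift p'.2.1.2, p'.2.1.1) : Edge 3 L) = b),
            w (plaquetteHolonomy U p.1 p.2.1.1 p.2.1.2) / (∫ g, w g ∂(haarProbability G))).prod *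
          coordAvg (haarProbability G) l.toFinset
            (fun V : GaugeConfig 3 L G => ∏ p ∈ (Finset.univ : Finset (Plaquette 3 L)).filter
              (fun p => p.1 (Fin.last 2) ≠ -1 ∧ p.2.1.2 = Fin.last 2),
                w (plaquetteHolonomy V p.1 p.2.1.1 p.2.1.2)) U /
          (∫ V, ∏ p ∈ (Finset.univ : Finset (Plaquette 3 L)).filter
              (fun p => p.1 (Fin.last 2) ≠ -1 ∧ p.2.1.2 = Fin.last 2),
                w (plaquetteHolonomy V p.1 p.2.1.1 p.2.1.2)
            ∂(Measure.pi fun _ : Edge 3 L => haarProbability G))) U V := by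
  have h := layers_imhAcceptQ_ge (n := 1) (G := G) hL hw hm0 hm hM l hl hall U V
  rwa [card_compl_layers_three] at h

/-! ## §3 Three and more dimensions: the certified floor decays with the volume -/

omit [NeZero L] in
/-- With `0 < m ≤ M` and `#plaquettes ≤ 6k`: `(m/M)^k ≤ (m/M)^{#plaquettes/6}`. [ours] -/
theorem pow_div_le_pow_card_div_six {m M : ℝ} (hm0 : 0 < m) (hmM : m ≤ M) {P k : ℕ} (hPk : P ≤ 6 * k) :
    (m / M) ^ k ≤ (m / M) ^ (P / 6) :=
  pow_le_pow_of_le_one (div_nonneg hm0.le (hm0.le.trans hmM)) (div_le_one_of_le₀ hmM (hm0.le.trans hmM))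
    (Nat.div_le_of_le_mul (by omega))

/-- **`d ≥ 3`: for EVERY ranked structure the Doeblin floor is at most `(m/M)^{#plaquettes/6}`.**  `B`
ranked for a top-link assignment injective on `B` (the datum of an exact one-plaquette heat-bath
autoregression); then the pointwise acceptance floor `(m/M)^{#Bᶜ}` of `ranked_imhAcceptQ_ge` — attained at
the worst pair of states up to the factor structure — satisfies `(m/M)^{#Bᶜ} ≤ (m/M)^{#plaquettes/6}`, and
`#sites·d(d−1) ≤ 12·#Bᶜ`.  The guarantee decays exponentially in the volume; whether the sampler does is
NOT claimed here. [ours] -/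
theorem ranked_doeblin_floor_le_pow_card_div_six {d : ℕ} (hd : 3 ≤ d) {m M : ℝ} (hm0 : 0 < m)
    (hmM : m ≤ M) (B : Finset (Plaquette d L)) (t : Plaquette d L → Edge d L)
    (ht : ∀ p ∈ B, t p ∈ ({(p.1, p.2.1.1), (p.1.shift p.2.1.1, p.2.1.2),
        (p.1.shift p.2.1.2, p.2.1.1), (p.1, p.2.1.2)} : Finset (Edge d L)))
    (hinj : Set.InjOn t B) (rank : Plaquette d L → ℕ)
    (hrank : ∀ p ∈ B, ∀ p' ∈ B, p ≠ p' → t p ∈ ({(p'.1, p'.2.1.1), (p'.1.shift p'.2.1.1, p'.2.1.2),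
        (p'.1.shift p'.2.1.2, p'.2.1.1), (p'.1, p'.2.1.2)} : Finset (Edge d L)) → rank p < rank p') :
    (m / M) ^ (Finset.univ \ B).card ≤ (m / M) ^ (Fintype.card (Plaquette d L) / 6) ∧
      Fintype.card (Site d L) * (d * (d - 1)) ≤ 12 * (Finset.univ \ B).card :=
  ⟨pow_div_le_pow_card_div_six hm0 hmM
      (card_plaquette_le_six_mul_card_compl_of_ranked hd B t ht hinj rank hrank),
    card_site_mul_le_twelve_mul_card_compl_of_ranked hd B t ht hinj rank hrank⟩

/-- **THE PARITY FLOOR: `(m/M)^k ≤ (m/M)^{#plaquettes + #sites − #links − 1}`** for every ranked structure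
(`L ≥ 2`, `0 < m ≤ M`; `TorusRankedParityBound.card_plaquette_add_card_site_le_of_ranked`) — in `d = 3`
the certified acceptance floor of ANY exact one-plaquette heat-bath proposal is at most `(m/M)^{L³−1}`
(`pow_three_le_card_compl_add_one_of_ranked`). [ours] -/
theorem ranked_doeblin_floor_le_pow_parity {d : ℕ} (hL : 2 ≤ L) {m M : ℝ} (hm0 : 0 < m) (hmM : m ≤ M)
    (B : Finset (Plaquette d L)) (t : Plaquette d L → Edge d L)
    (ht : ∀ p ∈ B, t p ∈ ({(p.1, p.2.1.1), (p.1.shift p.2.1.1, p.2.1.2),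
        (p.1.shift p.2.1.2, p.2.1.1), (p.1, p.2.1.2)} : Finset (Edge d L)))
    (rank : Plaquette d L → ℕ)
    (hrank : ∀ p ∈ B, ∀ p' ∈ B, p ≠ p' → t p ∈ ({(p'.1, p'.2.1.1), (p'.1.shift p'.2.1.1, p'.2.1.2),
        (p'.1.shift p'.2.1.2, p'.2.1.1), (p'.1, p'.2.1.2)} : Finset (Edge d L)) → rank p < rank p') :
    (m / M) ^ (Finset.univ \ B).card ≤
      (m / M) ^ (Fintype.card (Plaquette d L) + Fintype.card (Site d L) - Fintype.card (Edge d L) - 1) := by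
  have h := card_plaquette_add_card_site_le_of_ranked hL B t ht rank hrank
  exact pow_le_pow_of_le_one (div_nonneg hm0.le (hm0.le.trans hmM))
    (div_le_one_of_le₀ hmM (hm0.le.trans hmM)) (by omega)

end Summit.Ventures.LatticeQCDFlow.Theory2.Autoregressive

end
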